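import Summits.QuantumFields.YangMills.Theorems.ForcedResponseSkewnessFemtoEngineDefs
import Summits.QuantumFields.YangMills.Theorems.ForcedResponseSkewnessResponseLocalisationSignedToolkit
import HarnessLib

/-!
# Route `ForcedResponseSkewness`: the femto engine interface MOVES BETWEEN COMPARABLE UNITS (lead `ym-line-frs-p1` g7, 2026-08-28)

Helper file (`--supports stmt-QuantumFields-26871`, also serves 24275).  The three registered physics stubs (`FBL6OscSigR`,
`CentredOscLawSigR`, `CentredFemtoLogSigR`; bundle `FemtoEngineSigR`, Defs `Theorems/ForcedResponseSkewnessFemtoEngineDefs.lean`)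
quantify over EVERY unit map `a → 0⁺` pinned by a clause-(i) floor; an engine delivers the laws in ITS OWN unit `u`.  Here the
hypothesis-free bodies move from `u` to any unit `a` eventually two-sidedly comparable with `u` (`c·a ≤ u ≤ C·a`), by bookkeeping:
* `fbl6Osc_of_unit` — E0′ (`FBL6Osc`; only `u ≤ C·a` is used; femto side `ℓ₁/C`);
* `centredOscLaw_of_unit` — E-sym (`CentredOscLaw`; femto side `ℓ₂/C`, depth `d₀ ↦ c·d₀/3`, cut `R ↦ R/C`, the radial profile re-read
  in the other unit `φ(a‖w‖) = ψ(u‖w‖)`, `ψ(t) = φ(t·a/u)`, the ball enlarged by the finite `u`-ball — the extra terms vanish with `φ`);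
* `centredFemtoLog_of_unit` — E-log (`CentredFemtoLog`; the scale-indexed collar is REGULARISED through the running supremum
  `g(σ) = sup_{0<t≤min(σ,s₀)} t·K(t)` (a local `let`), `K_a(s) = max(1, g(C's)/(cs))` with `C' = max(C,2)`, still `s·K_a(s) → 0`; the logarithm loses a
  factor `4` since `log(1/(λs)) ≥ ½·log(1/s)` for `s ≤ 1/C'²`, `λ ≤ C'`);
* `femtoEngineAt_of_unit` — the bundle; **`femtoEngineSigR_of_ref : FemtoEngineRefSigR → FemtoEngineSigR`** — the route's declared
  debt is EXACTLY «the three laws in ONE unit per `(G, r)`» ∧ «clause-(i) floors pin the unit two-sidedly» (`FloorPinsUnit`)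
  (the converse, Sig ⇒ laws in every pinned unit, is definitional).
So an engine output typed in a unit of record (as the spine's crux 19353 statements are) discharges the route's stubs up to the ONE
interface fact `FloorPinsUnit` (fine side: no floor in a unit drifting finer than `u` — decay of the density two-point function beyond
the correlation length; coarse side: no floor in a unit drifting coarser — the asymptotic-freedom log ceiling).  HONEST LABEL:
bookkeeping on a conditional rung line (leaf R2a `BalabanLadder.NT`); none of E0′/E-sym/E-log, `FloorPinsUnit`, the cruxes
26871/24275, the residual, NT or the Yang–Mills mass gap is proved here or anywhere in the tree.
-/

set_option autoImplicit false

noncomputable section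

namespace Summit.QuantumFields.YangMills.Cruxes.ResponseLocalisation.FemtoEngine

open MeasureTheory Filter Topology Set
open Literature.MathematicalPhysics.QuantumFieldTheory Literature.MathematicalPhysics.QuantumLattice
open Literature.Probability.LatticeModels
open Summit.QuantumFields.YangMills.Cruxes.OSLegsFromFemtoAndGap.DlrCollarTransfer
open Summit.QuantumFields.YangMills.Cruxes.ResponseLocalisation.Birth
open Summit.QuantumFields.YangMills.Cruxes.ResponseLocalisation.Signed (mem_ballFinset)

variable {G : Type} [Group G] [TopologicalSpace G] [IsTopologicalGroup G] [CompactSpace G]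
  [MeasurableSpace G] [BorelSpace G] (r : LatticeRep G)

/-! ## §0 Elementary facts about two-sided comparability -/

/-- From `c·a ≤ u ≤ C·a` eventually and `a > 0`: `c ≤ C`, hence `0 < C` when `0 < c`. [folklore] -/
theorem le_of_comparable {a u : ℝ → ℝ} {c C : ℝ} (ha : ∀ β, 0 < a β)
    (hle : ∀ᶠ β in atTop, c * a β ≤ u β ∧ u β ≤ C * a β) : c ≤ C := by
  obtain ⟨β₀, hβ₀⟩ := Filter.eventually_atTop.1 hle
  have h := hβ₀ β₀ le_rfl
  exact le_of_mul_le_mul_right (h.1.trans h.2) (ha β₀)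

/-- Enlarging the upper constant keeps the comparison. [folklore] -/
theorem comparable_mono {a u : ℝ → ℝ} {c C C' : ℝ} (ha : ∀ β, 0 < a β) (hCC' : C ≤ C')
    (hle : ∀ᶠ β in atTop, c * a β ≤ u β ∧ u β ≤ C * a β) :
    ∀ᶠ β in atTop, c * a β ≤ u β ∧ u β ≤ C' * a β :=
  hle.mono fun β h => ⟨h.1, h.2.trans (mul_le_mul_of_nonneg_right hCC' (ha β).le)⟩
/-! ## §1 E0′: the plane-resolved boundary law in oscillation form -/

/-- **E0′ moves to any unit not finer than `u/C`**: `FBL6Osc G r u` and `u ≤ C·a` eventually give `FBL6Osc G r a` (femto side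
`ℓ₁/C`, same `D, C₁`). [folklore] -/
theorem fbl6Osc_of_unit {a u : ℝ → ℝ} {C : ℝ} (hC : 0 < C) (hle : ∀ᶠ β in atTop, u β ≤ C * a β)
    (h : FBL6Osc G r u) : FBL6Osc G r a := by
  obtain ⟨D, C₁, β₁, ℓ₁, hℓ₁, H⟩ := h
  obtain ⟨β₀, hβ₀⟩ := Filter.eventually_atTop.1 hle
  refine ⟨D, C₁, max β₁ β₀, ℓ₁ / C, div_pos hℓ₁ hC, fun β hβ R hR hRa η η' => ?_⟩
  have hβ₁ : β₁ ≤ β := (le_max_left _ _).trans hβ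
  have hua : u β ≤ C * a β := hβ₀ β ((le_max_right _ _).trans hβ)
  refine H β hβ₁ R hR ?_ η η'
  rw [le_div_iff₀ hC] at hRa
  have h0 : (0 : ℝ) ≤ ((2 * R + 1 : ℕ) : ℝ) := Nat.cast_nonneg _
  calc ((2 * R + 1 : ℕ) : ℝ) * u β ≤ ((2 * R + 1 : ℕ) : ℝ) * (C * a β) := mul_le_mul_of_nonneg_left hua h0
    _ = ((2 * R + 1 : ℕ) : ℝ) * a β * C := by ring
    _ ≤ ℓ₁ := hRa
/-! ## §2 E-sym: the centred reference-free oscillation law -/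

/-- **E-sym moves between two-sidedly comparable units**: `CentredOscLaw G r u` and `c·a ≤ u ≤ C·a` eventually (`0 < c`) give
`CentredOscLaw G r a`. [folklore] -/
theorem centredOscLaw_of_unit {a u : ℝ → ℝ} {c C : ℝ} (hc : 0 < c) (ha : ∀ β, 0 < a β) (hu : ∀ β, 0 < u β)
    (hle : ∀ᶠ β in atTop, c * a β ≤ u β ∧ u β ≤ C * a β) (h : CentredOscLaw G r u) :
    CentredOscLaw G r a := by
  have hcC : c ≤ C := le_of_comparable ha hle
  have hC : 0 < C := hc.trans_le hcC
  obtain ⟨ℓ₂, hℓ₂, H⟩ := h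
  obtain ⟨β₀, hβ₀⟩ := Filter.eventually_atTop.1 hle
  refine ⟨ℓ₂ / C, div_pos hℓ₂ hC, fun κ hκ d₀ hd₀ hd₀ℓ => ?_⟩
  -- ask the `u`-law at depth `c·d₀/3`
  have hd₀u : 0 < c * d₀ / 3 := by positivity
  have hd₀uℓ : c * d₀ / 3 ≤ ℓ₂ := by
    have h1 : c * d₀ / 3 ≤ C * (ℓ₂ / C) / 1 := by
      rw [div_one]
      have : c * d₀ ≤ C * (ℓ₂ / C) := mul_le_mul hcC hd₀ℓ hd₀.le hC.le
      linarith [this, mul_nonneg hc.le hd₀.le]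
    rw [mul_div_cancel₀ _ hC.ne', div_one] at h1
    exact h1
  obtain ⟨R, hR, hRd, β₂, HH⟩ := H κ hκ (c * d₀ / 3) hd₀u hd₀uℓ
  refine ⟨R / C, div_pos hR hC, ?_, max β₂ β₀, fun β hβ N hNℓ hNR hNd η η' B hB φ hφ1 hφ0 => ?_⟩
  · -- `R/C ≤ d₀`
    rw [div_le_iff₀ hC]
    calc R ≤ c * d₀ / 3 := hRd
      _ ≤ d₀ * C := by nlinarith [hd₀, hcC, hc]
  have hβ₂ : β₂ ≤ β := (le_max_left _ _).trans hβ
  have hcmp := hβ₀ β ((le_max_right _ _).trans hβ)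
  have haβ := ha β
  have huβ := hu β
  -- the `u`-hypotheses at the same radius `N`
  have hNℓu : ((2 * N + 1 : ℕ) : ℝ) * u β ≤ ℓ₂ := by
    rw [le_div_iff₀ hC] at hNℓ
    have h0 : (0 : ℝ) ≤ ((2 * N + 1 : ℕ) : ℝ) := Nat.cast_nonneg _
    calc ((2 * N + 1 : ℕ) : ℝ) * u β ≤ ((2 * N + 1 : ℕ) : ℝ) * (C * a β) := mul_le_mul_of_nonneg_left hcmp.2 h0
      _ = ((2 * N + 1 : ℕ) : ℝ) * a β * C := by ring
      _ ≤ ℓ₂ := hNℓ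
  have hN2 : (2 : ℝ) ≤ N := by
    have h1 : 0 < R / C / a β := div_pos (div_pos hR hC) haβ
    have h2 : (1 : ℝ) < N := by linarith
    have h3 : 1 < N := by exact_mod_cast h2
    exact_mod_cast h3
  have hNRu : R / u β + 2 ≤ (N : ℝ) + 1 := by
    have h1 : R ≤ u β * (((N : ℝ) + 1) / 3) := by
      calc R ≤ c * d₀ / 3 := hRd
        _ ≤ c * (a β * ((N : ℝ) + 1)) / 3 := by gcongr
        _ = c * a β * (((N : ℝ) + 1) / 3) := by ring
        _ ≤ u β * (((N : ℝ) + 1) / 3) := by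
            apply mul_le_mul_of_nonneg_right hcmp.1; positivity
    rw [← le_sub_iff_add_le, div_le_iff₀ huβ]
    calc R ≤ u β * (((N : ℝ) + 1) / 3) := h1
      _ ≤ ((N : ℝ) + 1 - 2) * u β := by nlinarith [huβ, hN2]
  have hNdu : c * d₀ / 3 ≤ u β * ((N : ℝ) + 1) := by
    calc c * d₀ / 3 ≤ c * d₀ := by nlinarith [mul_nonneg hc.le hd₀.le]
      _ ≤ c * (a β * ((N : ℝ) + 1)) := by gcongr
      _ = c * a β * ((N : ℝ) + 1) := by ring
      _ ≤ u β * ((N : ℝ) + 1) := by apply mul_le_mul_of_nonneg_right hcmp.1; positivity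
  -- the profile in the `u`-unit and the enlarged ball
  set ψ : ℝ → ℝ := fun t => φ (t * (a β / u β)) with hψ
  have hψ1 : ∀ t, |ψ t| ≤ 1 := fun t => hφ1 _
  have hψ0 : ∀ t, R ≤ t → ψ t = 0 := by
    intro t ht
    apply hφ0
    have h1 : R / C ≤ R * (a β / u β) := by
      rw [div_le_iff₀ hC, mul_assoc]
      have h2 : 1 ≤ a β / u β * C := by
        rw [div_mul_eq_mul_div, le_div_iff₀ huβ, one_mul, mul_comm]; exact hcmp.2
      calc R = R * 1 := (mul_one R).symm
        _ ≤ R * (a β / u β * C) := mul_le_mul_of_nonneg_left h2 hR.le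
    exact h1.trans (mul_le_mul_of_nonneg_right ht (div_pos haβ huβ).le)
  set S : Finset (Fin 4 → ℤ) := (Fintype.piFinset fun _ : Fin 4 => Finset.Icc (-(⌊R / u β⌋₊ : ℤ)) ⌊R / u β⌋₊).filter
      (fun w => u β * ‖siteToE w‖ < R) with hS
  have hBS : ∀ w : Fin 4 → ℤ, u β * ‖siteToE w‖ < R → w ∈ B ∪ S :=
    fun w hw => Finset.mem_union_right _ (mem_ballFinset huβ w hw)
  have key := HH β hβ₂ N hNℓu hNRu hNdu η η' (B ∪ S) hBS ψ hψ1 hψ0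
  -- the two sums agree term by term
  have hψφ : ∀ w : Fin 4 → ℤ, ψ (u β * ‖siteToE w‖) = φ (a β * ‖siteToE w‖) := by
    intro w
    simp only [hψ]
    congr 1
    field_simp
  have hsum : ∑ w ∈ B ∪ S, ψ (u β * ‖siteToE w‖) *
        (kerCov G r β (fun _ => -(N : ℤ)) (2 * N + 1) η (dens G r w) (dens G r 0) -
          kerCov G r β (fun _ => -(N : ℤ)) (2 * N + 1) η' (dens G r w) (dens G r 0)) =
      ∑ w ∈ B, φ (a β * ‖siteToE w‖) *
        (kerCov G r β (fun _ => -(N : ℤ)) (2 * N + 1) η (dens G r w) (dens G r 0) -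
          kerCov G r β (fun _ => -(N : ℤ)) (2 * N + 1) η' (dens G r w) (dens G r 0)) := by
    simp_rw [hψφ]
    symm
    apply Finset.sum_subset Finset.subset_union_left
    intro w _ hwB
    have hwR : R / C ≤ a β * ‖siteToE w‖ := by
      by_contra hlt
      exact hwB (hB w (lt_of_not_ge hlt))
    rw [hφ0 _ hwR, zero_mul]
  rw [hsum] at key
  exact key

/-! ## §3 E-log: the centred femto log two-point law (regularised scale-indexed collar) -/


/-- **E-log moves between two-sidedly comparable units**: `CentredFemtoLog G r u` and `c·a ≤ u ≤ C·a` eventually (`0 < c`)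
give `CentredFemtoLog G r a` (constant `4·max(C₂,0)`, regularised collar `max(1, g(C's)/(cs))` with `C' = max C 2`). [folklore] -/
theorem centredFemtoLog_of_unit {a u : ℝ → ℝ} {c C : ℝ} (hc : 0 < c) (ha : ∀ β, 0 < a β) (hu : ∀ β, 0 < u β)
    (hle : ∀ᶠ β in atTop, c * a β ≤ u β ∧ u β ≤ C * a β) (h : CentredFemtoLog G r u) :
    CentredFemtoLog G r a := by
  -- enlarge the upper constant to `C' ≥ 2`
  set C' : ℝ := max C 2 with hC'
  have hle' : ∀ᶠ β in atTop, c * a β ≤ u β ∧ u β ≤ C' * a β := comparable_mono ha (le_max_left _ _) hle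
  have hC'2 : (2 : ℝ) ≤ C' := le_max_right _ _
  have hC' : 0 < C' := by positivity
  have hcC' : c ≤ C' := le_of_comparable ha hle'
  obtain ⟨ℓ₂, C₂, β₂, K, n₀, hℓ₂, hK1, hKt, H⟩ := h
  obtain ⟨β₀, hβ₀⟩ := Filter.eventually_atTop.1 hle'
  -- `t·K(t) ≤ 1` on `(0, s₀]`
  obtain ⟨s₀, hs₀pos, hs₀⟩ : ∃ s₀ : ℝ, 0 < s₀ ∧ ∀ t, 0 < t → t ≤ s₀ → t * K t ≤ 1 := by
    have h1 := Metric.tendsto_nhdsWithin_nhds.1 hKt 1 one_pos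
    obtain ⟨δ, hδ, hδ'⟩ := h1
    refine ⟨δ / 2, by positivity, fun t ht hts => ?_⟩
    have h2 : dist (t * K t) 0 < 1 := hδ' (Set.mem_Ioi.2 ht) (by rw [dist_zero_right, Real.norm_of_nonneg ht.le]; linarith)
    rw [dist_zero_right, Real.norm_eq_abs] at h2
    exact (le_abs_self _).trans h2.le
  -- the running supremum `g(σ) = sup_{0<t≤min(σ,s₀)} t·K(t)` and the regularised collar in the `a`-unit
  let g : ℝ → ℝ := fun σ => sSup ((fun t => t * K t) '' Set.Ioc 0 (min σ s₀))
  have hbdd : ∀ σ, BddAbove ((fun t => t * K t) '' Set.Ioc 0 (min σ s₀)) := fun σ =>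
    ⟨1, by rintro _ ⟨t, ht, rfl⟩; exact hs₀ t ht.1 (ht.2.trans (min_le_right _ _))⟩
  have hne : ∀ σ, 0 < σ → ((fun t => t * K t) '' Set.Ioc 0 (min σ s₀)).Nonempty := fun σ hσ =>
    ⟨_, ⟨min σ s₀, ⟨lt_min hσ hs₀pos, le_rfl⟩, rfl⟩⟩
  have le_g : ∀ {σ t : ℝ}, 0 < t → t ≤ σ → t ≤ s₀ → t * K t ≤ g σ := fun ht htσ hts =>
    le_csSup (hbdd _) ⟨_, ⟨ht, le_min htσ hts⟩, rfl⟩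
  have g_nonneg : ∀ {σ : ℝ}, 0 < σ → 0 ≤ g σ := fun {σ} hσ =>
    le_trans (by nlinarith [hK1 (min σ s₀), lt_min hσ hs₀pos]) (le_g (lt_min hσ hs₀pos) (min_le_left _ _) (min_le_right _ _))
  have g_le : ∀ {σ ε : ℝ}, 0 < σ → (∀ t, 0 < t → t ≤ σ → t * K t ≤ ε) → g σ ≤ ε := fun hσ hε =>
    csSup_le (hne _ hσ) (by rintro _ ⟨t, ht, rfl⟩; exact hε t ht.1 (ht.2.trans (min_le_left _ _)))
  let Ka : ℝ → ℝ := fun s => max 1 (g (C' * s) / (c * s))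
  have hKa1 : ∀ s, 1 ≤ Ka s := fun s => le_max_left _ _
  have hKa_dom : ∀ s : ℝ, 0 < s → C' * s ≤ s₀ → ∀ lam : ℝ, c ≤ lam → lam ≤ C' → K (lam * s) ≤ Ka s := by
    intro s hs hCs lam hcl hlC
    have hlam : 0 < lam := hc.trans_le hcl
    have hls : 0 < lam * s := mul_pos hlam hs
    have h1 : lam * s * K (lam * s) ≤ g (C' * s) :=
      le_g hls (mul_le_mul_of_nonneg_right hlC hs.le) ((mul_le_mul_of_nonneg_right hlC hs.le).trans hCs)
    have h2 : K (lam * s) ≤ g (C' * s) / (lam * s) := by rw [le_div_iff₀ hls]; linarith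
    have h3 : g (C' * s) / (lam * s) ≤ g (C' * s) / (c * s) := by
      apply div_le_div_of_nonneg_left _ (mul_pos hc hs) (mul_le_mul_of_nonneg_right hcl hs.le)
      exact g_nonneg (mul_pos hC' hs)
    exact (h2.trans h3).trans (le_max_right _ _)
  have hKat : Tendsto (fun s : ℝ => s * Ka s) (nhdsWithin 0 (Set.Ioi 0)) (nhds 0) := by
    have hg : Tendsto (fun s : ℝ => g (C' * s) / c) (nhdsWithin 0 (Set.Ioi 0)) (nhds 0) := by
      rw [Metric.tendsto_nhdsWithin_nhds]
      intro ε hε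
      obtain ⟨δ, hδ, hδ'⟩ := Metric.tendsto_nhdsWithin_nhds.1 hKt (ε * c / 2) (by positivity)
      refine ⟨δ / C', div_pos hδ hC', fun s hs hsd => ?_⟩
      have hs' : 0 < s := Set.mem_Ioi.1 hs
      rw [dist_zero_right, Real.norm_of_nonneg hs'.le] at hsd
      have hCs : 0 < C' * s := mul_pos hC' hs'
      have h1 : g (C' * s) ≤ ε * c / 2 := by
        apply g_le hCs
        intro t ht htσ
        have htδ : t < δ := by
          calc t ≤ C' * s := htσ
            _ < C' * (δ / C') := by gcongr
            _ = δ := mul_div_cancel₀ _ hC'.ne'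
        have h2 := hδ' (Set.mem_Ioi.2 ht) (by rw [dist_zero_right, Real.norm_of_nonneg ht.le]; exact htδ)
        rw [dist_zero_right, Real.norm_eq_abs] at h2
        exact (le_abs_self _).trans h2.le
      have h0 : 0 ≤ g (C' * s) := g_nonneg hCs
      rw [dist_zero_right, Real.norm_of_nonneg (div_nonneg h0 hc.le), div_lt_iff₀ hc]
      nlinarith
    have hmax : Tendsto (fun s : ℝ => max s (g (C' * s) / c)) (nhdsWithin 0 (Set.Ioi 0)) (nhds 0) := by
      have h0 : Tendsto (fun s : ℝ => s) (nhdsWithin 0 (Set.Ioi 0)) (nhds 0) :=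
        tendsto_nhdsWithin_of_tendsto_nhds tendsto_id
      simpa using h0.max hg
    refine hmax.congr' ?_
    filter_upwards [self_mem_nhdsWithin] with s hs
    have hs' : 0 < s := Set.mem_Ioi.1 hs
    show max s (g (C' * s) / c) = s * max 1 (g (C' * s) / (c * s))
    rw [mul_max_of_nonneg _ _ hs'.le, mul_one]
    congr 1
    field_simp
  -- the transferred data
  refine ⟨min (ℓ₂ / C') (min (s₀ / C') (1 / C' ^ 2)), 4 * max C₂ 0, max β₂ β₀, Ka, n₀, by positivity, hKa1, hKat,
    fun β hβ N hNℓ η y hy hyN => ?_⟩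
  have hβ₂ : β₂ ≤ β := (le_max_left _ _).trans hβ
  have hcmp := hβ₀ β ((le_max_right _ _).trans hβ)
  have haβ := ha β
  have huβ := hu β
  set ny : ℝ := ‖siteToE y‖ with hny
  have hny0 : 0 ≤ ny := norm_nonneg _
  have hRHS0 : 0 ≤ 4 * max C₂ 0 / Real.log (1 / (ny * a β)) ^ 2 := by positivity
  rcases hny0.eq_or_lt with hz | hpos
  · -- degenerate pair `y = 0`
    have h0 : ny ^ 8 = 0 := by rw [← hz]; norm_num
    rw [h0, zero_mul]; exact hRHS0
  -- femto cube in the `u`-unit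
  have hN0 : (0 : ℝ) ≤ ((2 * N + 1 : ℕ) : ℝ) := Nat.cast_nonneg _
  have hNℓu : ((2 * N + 1 : ℕ) : ℝ) * u β ≤ ℓ₂ := by
    have h1 : ((2 * N + 1 : ℕ) : ℝ) * a β ≤ ℓ₂ / C' := hNℓ.trans (min_le_left _ _)
    rw [le_div_iff₀ hC'] at h1
    calc ((2 * N + 1 : ℕ) : ℝ) * u β ≤ ((2 * N + 1 : ℕ) : ℝ) * (C' * a β) := mul_le_mul_of_nonneg_left hcmp.2 hN0
      _ = ((2 * N + 1 : ℕ) : ℝ) * a β * C' := by ring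
      _ ≤ ℓ₂ := h1
  -- the physical separations in the two units
  set sa : ℝ := ny * a β with hsa
  set lam : ℝ := u β / a β with hlam
  have hsa0 : 0 < sa := mul_pos hpos haβ
  have hlam_c : c ≤ lam := by rw [hlam, le_div_iff₀ haβ]; exact hcmp.1
  have hlam_C : lam ≤ C' := by rw [hlam, div_le_iff₀ haβ]; exact hcmp.2
  have hsu : ny * u β = lam * sa := by rw [hlam, hsa]; field_simp
  have hny_le : ny ≤ (N : ℝ) + 1 := by
    have h1 : ny ≤ (Ka sa + 1) * ny := by
      have : 1 ≤ Ka sa + 1 := by linarith [hKa1 sa]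
      exact le_mul_of_one_le_left hny0 this
    exact h1.trans hyN
  have hsa_le : sa ≤ min (ℓ₂ / C') (min (s₀ / C') (1 / C' ^ 2)) := by
    calc sa = ny * a β := rfl
      _ ≤ ((N : ℝ) + 1) * a β := mul_le_mul_of_nonneg_right hny_le haβ.le
      _ ≤ ((2 * N + 1 : ℕ) : ℝ) * a β := by
          apply mul_le_mul_of_nonneg_right _ haβ.le; push_cast; linarith [Nat.cast_nonneg (α := ℝ) N]
      _ ≤ _ := hNℓ
  have hCsa : C' * sa ≤ s₀ := by
    have h1 : sa ≤ s₀ / C' := (hsa_le.trans (min_le_right _ _)).trans (min_le_left _ _)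
    rw [le_div_iff₀ hC'] at h1; linarith
  have hsaC2 : sa ≤ 1 / C' ^ 2 := (hsa_le.trans (min_le_right _ _)).trans (min_le_right _ _)
  -- collar in the `u`-unit
  have hKu : K (ny * u β) ≤ Ka sa := by rw [hsu]; exact hKa_dom sa hsa0 hCsa lam hlam_c hlam_C
  have hyNu : (K (ny * u β) + 1) * ny ≤ (N : ℝ) + 1 :=
    le_trans (mul_le_mul_of_nonneg_right (by linarith) hny0) hyN
  have key := H β hβ₂ N hNℓu η y hy hyNu
  -- compare the logarithms: log(1/(λ s)) ≥ ½ log(1/s) when s ≤ 1/C'², λ ≤ C', C' ≥ 2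
  have hLa_pos : 0 < Real.log (1 / sa) := by
    apply Real.log_pos
    rw [lt_div_iff₀ hsa0, one_mul]
    calc sa ≤ 1 / C' ^ 2 := hsaC2
      _ < 1 := by rw [div_lt_one (by positivity)]; nlinarith
  have hlogC : Real.log C' ≤ Real.log (1 / sa) / 2 := by
    have h1 : C' ^ 2 ≤ 1 / sa := by
      rw [le_div_iff₀ hsa0]
      calc C' ^ 2 * sa ≤ C' ^ 2 * (1 / C' ^ 2) := mul_le_mul_of_nonneg_left hsaC2 (by positivity)
        _ = 1 := by field_simp
    have h2 : Real.log (C' ^ 2) ≤ Real.log (1 / sa) := Real.log_le_log (by positivity) h1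
    rw [Real.log_pow] at h2
    push_cast at h2
    linarith
  have hLu_ge : Real.log (1 / sa) / 2 ≤ Real.log (1 / (ny * u β)) := by
    have h4 : Real.log (1 / (ny * u β)) = Real.log (1 / sa) - Real.log lam := by
      rw [hsu, one_div, Real.log_inv, one_div, Real.log_inv, Real.log_mul (hc.trans_le hlam_c).ne' hsa0.ne']
      ring
    have h3 : Real.log lam ≤ Real.log C' := Real.log_le_log (hc.trans_le hlam_c) hlam_C
    rw [h4]
    linarith [hlogC]
  have hLu_pos : 0 < Real.log (1 / (ny * u β)) := by linarith
  have hsq : Real.log (1 / sa) ^ 2 ≤ 4 * Real.log (1 / (ny * u β)) ^ 2 := by nlinarith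
  calc ny ^ 8 * |kerCov G r β (fun _ => -(N : ℤ)) (2 * N + 1) η (dens G r 0) (dens G r y)|
      ≤ C₂ / Real.log (1 / (ny * u β)) ^ 2 := key
    _ ≤ max C₂ 0 / Real.log (1 / (ny * u β)) ^ 2 :=
        div_le_div_of_nonneg_right (le_max_left _ _) (by positivity)
    _ ≤ 4 * max C₂ 0 / Real.log (1 / sa) ^ 2 := by
        rw [div_le_div_iff₀ (by positivity) (by positivity)]
        calc max C₂ 0 * Real.log (1 / sa) ^ 2 ≤ max C₂ 0 * (4 * Real.log (1 / (ny * u β)) ^ 2) :=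
              mul_le_mul_of_nonneg_left hsq (le_max_right _ _)
          _ = 4 * max C₂ 0 * Real.log (1 / (ny * u β)) ^ 2 := by ring

/-! ## §4 The bundle and the Sig-level certificate -/

/-- **The three engine laws move between two-sidedly comparable units.** [folklore] -/
theorem femtoEngineAt_of_unit {a u : ℝ → ℝ} {c C : ℝ} (hc : 0 < c) (ha : ∀ β, 0 < a β) (hu : ∀ β, 0 < u β)
    (hle : ∀ᶠ β in atTop, c * a β ≤ u β ∧ u β ≤ C * a β) (h : FemtoEngineAt G r u) :
    FemtoEngineAt G r a := by
  have hC : 0 < C := hc.trans_le (le_of_comparable ha hle)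
  exact ⟨fbl6Osc_of_unit r hC (hle.mono fun β h => h.2) h.1, centredOscLaw_of_unit r hc ha hu hle h.2.1,
    centredFemtoLog_of_unit r hc ha hu hle h.2.2⟩

omit [MeasurableSpace G] [BorelSpace G] in
/-- **The interface in a reference unit implies the registered interface**: laws in ONE unit per `(G, r)` plus two-sided unit
pinning by clause-(i) floors give `FemtoEngineSigR` (hence both cruxes and, with the residual, `NT`, by
`FemtoEngine.nt_of_femtoEngine`).  Nothing of E0′/E-sym/E-log or `FloorPinsUnit` is proved. [folklore] -/
theorem femtoEngineSigR_of_ref (hR : FemtoEngineRefSigR) : FemtoEngineSigR := by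
  -- the three laws in every pinned unit, from the reference unit
  have key : ∀ (G : Type) [Group G] [TopologicalSpace G] [IsTopologicalGroup G] [CompactSpace G],
      IsCompactSimpleLieGroup G →
      letI : MeasurableSpace G := borel G
      haveI : BorelSpace G := ⟨rfl⟩
      ∀ (r : LatticeRep G) (a : ℝ → ℝ), (∀ β, 0 < a β) → Filter.Tendsto a Filter.atTop (nhds 0) →
        (∃ (v₀ : SchwartzMap (EuclideanSpace ℝ (Fin 4)) ℝ) (ε β₅ Λ₅ : ℝ), HasCompactSupport v₀ ∧
          tsupport v₀ ⊆ {y : EuclideanSpace ℝ (Fin 4) | 0 < y 0} ∧ 0 < ε ∧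
          ∀ β : ℝ, β₅ ≤ β → ∀ L : ℕ, Λ₅ ≤ a β * L → ε ≤ Q2 G r β L (a β) (thetaTest 4 v₀) v₀) →
        FemtoEngineAt G r a := by
    intro G _ _ _ _ hG
    letI : MeasurableSpace G := borel G
    haveI : BorelSpace G := ⟨rfl⟩
    intro r a ha ha0 hpin
    obtain ⟨u, hu, -, hE, hP⟩ := hR G hG r
    obtain ⟨c, C, hc, hle⟩ := hP a ha ha0 hpin
    exact femtoEngineAt_of_unit r hc ha hu hle hE
  exact ⟨fun G _ _ _ _ hG r a ha ha0 hpin => (key G hG r a ha ha0 hpin).1,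
    fun G _ _ _ _ hG r a ha ha0 hpin => (key G hG r a ha ha0 hpin).2.1,
    fun G _ _ _ _ hG r a ha ha0 hpin => (key G hG r a ha ha0 hpin).2.2⟩

end Summit.QuantumFields.YangMills.Cruxes.ResponseLocalisation.FemtoEngine

end
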